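import Mathlib
import Summits.ValiantsHypothesis.ValiantsHypothesis.Theorems.BarrierLeverDefinableEquationsSparsityWall
import Summits.ValiantsHypothesis.ValiantsHypothesis.Theorems.BarrierLeverDefinableEquationsDegreeLowerBound

/-!
# Crux `BarrierLever.DefinableEquations` (stmt-8745) / `SingleSizeEquations` (stmt-8749) —
# SPARSITY WALL, sharpened step: an equation for size `s` has `≥ 2^{(s - 2n - 1)/(n+1) + 1}`
# monomials; at the open rung `b = 2`: `≥ 2^{n-2}` (val-np-p5 g12)

`…SparsityWall.lean` (val-np-p5 g8) runs the halving recursion `T(s) ≥ 2 T(s - (2n+2))` down the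
size axis: translating `f ↦ f + t·x^μ` was charged `2n + 2` gates through the Literature bound
`L(t·x^μ) ≤ 2|μ| + 1`.  The honest cost of a scaled monomial of degree `≤ n` is `|μ|` gates
(`|μ| - 1` products, one scalar gate: `complexity_monomial_le_degree`), so one halving step costs
`n + 1` (`translate_mem_sharp`) and the recursion runs twice as long inside the same budget:

* `card_support_ge_two_pow_sharp` — every nonzero `E` vanishing at `coeff(g)` for all `g` of
  degree `≤ n` and size `≤ s` with `2n + 1 + r(n+1) ≤ s` has `≥ 2^(r+1)` monomials;
* `rung_two_card_support_sharp` — at the OPEN rung `b = 2` (`n ≥ 3`): every nonzero equation for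
  `SmallCircuits ℂ n 2`, in particular every Boolean-sum witness of the crux at `(n, 2)`, has at
  least `2^(n-2)` monomials (the g8 wall: `2^((n-4)/2+1) ≈ 2^{n/2}`; `N = C(2n,n) ≤ 4^n`, so the
  wall moves from `≈ N^{1/4}` to `≈ N^{1/2}`); hitting form `isSuccinctHittingSet_sparse_rung_two_sharp`.

WHY THIS IS (NEARLY) THE END OF THE HALVING METHOD, honestly.  A `poly(N)`-SPARSE equation at
`b = 2` (any `N^a` monomials) would prove `SingleSizeEquations` at `b = 2` outright with `q = 0`
(an `N^a`-term polynomial has a circuit of size `≤ (N^a)(N^a + 1)`-ish); the tree excludes such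
witnesses only below `≈ N^{1/2}` now.  Pure halving cannot reach `N^a` for every `a`: each step
needs a direction `coeff(g)` with `L(g)` small, a fan-in-two circuit with `L` gates reads `≤ 2L`
variables, so cheap directions live on coordinates `c_μ` with small `|supp μ|`, and an adversary
`E` supported on heavy coordinates (`|supp μ| ≥ n/2`) forces `≥ n/4`-ish gates per halving, i.e.
`O(n)` halvings in `n²` gates = `N^{O(1)}` monomials at best.  Closing the sparse door at `b = 2`
for every `a` needs a non-vanishing theorem of secant type (rank-`r` sums of products of affine
forms against `2^{ω(r)}`-sparse polynomials); see the seat memo LANDSCAPE-8749-g12.md.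
WHAT THIS IS NOT: no verdict on the crux (b = 2 OPEN); nothing on `VP ≠ VNP`.  No definitions,
no named facts; standard axioms.  Refs: Bürgisser 2000 §2.1 (cost model).
-/

-- `Summit.ValiantsHypothesis.ValiantsHypothesis.…` repeats a component by the D-0017 layout
-- (single-conjunct summit), which the `dupNamespace` linter flags; the name is mandated.
set_option linter.dupNamespace false

noncomputable section

namespace Summit.ValiantsHypothesis.ValiantsHypothesis.Theorems.BarrierLeverDefinableEquations

open MvPolynomial
open Literature.Computability.AlgebraicComplexity Literature.Barriers.ValiantsHypothesis
open scoped BigOperators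

namespace SparsityWall

/-! ## §6 The honest cost of a scaled monomial: `L(t · x^μ) ≤ |μ|` -/

/-- `L(x_i^b) ≤ b - 1` for `b ≥ 1` (`b - 1` product gates). [cite: Burgisser2000, §2.1] -/
theorem complexity_X_pow_le_pred {σ : Type*} (i : σ) {b : ℕ} (hb : 1 ≤ b) :
    complexity ((X i : MvPolynomial σ ℂ) ^ b) ≤ b - 1 := by
  induction b, hb using Nat.le_induction with
  | base => rw [pow_one, complexity_X_holds]
  | succ b hb ih =>
    have h := complexity_mul_le_holds ((X i : MvPolynomial σ ℂ) ^ b) (X i)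
    rw [complexity_X_holds, ← pow_succ] at h
    omega

/-- **`L(t · x^μ) ≤ |μ|`**: `|μ| - 1` product gates for `x^μ` and one scalar gate (for `μ = 0`
the constant `t` is free). [cite: Burgisser2000, §2.1] -/
theorem complexity_monomial_le_degree {σ : Type*} (μ : σ →₀ ℕ) (t : ℂ) :
    complexity (monomial μ t : MvPolynomial σ ℂ) ≤ μ.degree := by
  classical
  induction μ using Finsupp.induction with
  | zero =>
    rw [map_zero, show (monomial (0 : σ →₀ ℕ) t : MvPolynomial σ ℂ) = C t from rfl,
      complexity_C_holds]
  | single_add a b g ha hb ih =>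
    -- `t x^{b e_a + g} = x_a^b · (t x^g)`
    have hsplit : (monomial (Finsupp.single a b + g) t : MvPolynomial σ ℂ) =
        (X a : MvPolynomial σ ℂ) ^ b * monomial g t := by
      rw [X_pow_eq_monomial, monomial_mul, one_mul]
    rw [hsplit, map_add, Finsupp.degree_single]
    have h1 := complexity_X_pow_le_pred (σ := σ) a (Nat.one_le_iff_ne_zero.mpr hb)
    have h2 := complexity_mul_le_holds ((X a : MvPolynomial σ ℂ) ^ b) (monomial g t)
    omega

/-- **Sharp translation cost.**  Adding a scaled monomial of degree `≤ n` to `f` costs at most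
`n + 1` gates and keeps the degree `≤ n` (the g8 file charged `2n + 2`). [cite: Burgisser2000, §2.1] -/
theorem translate_mem_sharp {n s : ℕ} {f : MvPolynomial (Fin n) ℂ} (hf : f.totalDegree ≤ n)
    (hL : complexity f ≤ s) (μ : ↥(degLEMonomials n)) (t : ℂ) :
    (f + monomial (μ : Fin n →₀ ℕ) t).totalDegree ≤ n ∧
      complexity (f + monomial (μ : Fin n →₀ ℕ) t) ≤ s + (n + 1) := by
  have hμ : (μ : Fin n →₀ ℕ).degree ≤ n := μ.2
  refine ⟨(totalDegree_add _ _).trans (max_le hf ?_), ?_⟩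
  · refine (totalDegree_monomial_le _ _).trans ?_
    rwa [Finsupp.degree_apply] at hμ
  · have hm := complexity_monomial_le_degree (μ : Fin n →₀ ℕ) t
    have ha := complexity_add_le_holds f (monomial (μ : Fin n →₀ ℕ) t : MvPolynomial (Fin n) ℂ)
    omega

/-! ## §7 Both pieces of the splitting are equations one SHARP rung (`n + 1`) down -/

/-- The line through `coeff(f)` in direction `e_μ` lies in the zero set of an equation for size
`s + n + 1` whenever `L(f) ≤ s`. [folklore] -/
theorem line_subset_zeros_sharp {n s : ℕ} {E : MvPolynomial ↥(degLEMonomials n) ℂ}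
    (hE : ∀ g : MvPolynomial (Fin n) ℂ, g.totalDegree ≤ n → complexity g ≤ s + (n + 1) →
      eval (coeffVector (degLEMonomials n) g) E = 0)
    {f : MvPolynomial (Fin n) ℂ} (hf : f.totalDegree ≤ n) (hL : complexity f ≤ s)
    (μ : ↥(degLEMonomials n)) (t : ℂ) :
    eval (fun ν => coeffVector (degLEMonomials n) f ν + if ν = μ then t else 0) E = 0 := by
  have h := (funext (DifferentialClosure.coeffVector_translate f μ t)).symm
  rw [show (fun ν => coeffVector (degLEMonomials n) f ν + if ν = μ then t else 0) =
      coeffVector (degLEMonomials n) (f + monomial (μ : Fin n →₀ ℕ) t) from h]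
  obtain ⟨hdeg, hsize⟩ := translate_mem_sharp hf hL μ t
  exact hE _ hdeg hsize

/-- **Top piece, sharp rung.**  If `E` is an equation for size `s + n + 1` then every `∂_μ^j E` is
an equation for size `s`. [folklore] -/
theorem iterate_pderiv_vanishes_sharp {n s : ℕ} {E : MvPolynomial ↥(degLEMonomials n) ℂ}
    (hE : ∀ g : MvPolynomial (Fin n) ℂ, g.totalDegree ≤ n → complexity g ≤ s + (n + 1) →
      eval (coeffVector (degLEMonomials n) g) E = 0)
    (μ : ↥(degLEMonomials n)) (j : ℕ)
    (f : MvPolynomial (Fin n) ℂ) (hf : f.totalDegree ≤ n) (hL : complexity f ≤ s) :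
    eval (coeffVector (degLEMonomials n) f) ((pderiv μ)^[j] E) = 0 :=
  iterate_pderiv_eval_eq_zero_of_line E _ μ (line_subset_zeros_sharp hE hf hL μ) j

/-- **Bottom piece, sharp rung.**  If `E` is an equation for size `s + n + 1` then
`(∂_μ^j E)(c_μ := 0)` is an equation for size `s`. [folklore] -/
theorem killVar_iterate_pderiv_vanishes_sharp {n s : ℕ} {E : MvPolynomial ↥(degLEMonomials n) ℂ}
    (hE : ∀ g : MvPolynomial (Fin n) ℂ, g.totalDegree ≤ n → complexity g ≤ s + (n + 1) →
      eval (coeffVector (degLEMonomials n) g) E = 0)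
    (μ : ↥(degLEMonomials n)) (j : ℕ)
    (f : MvPolynomial (Fin n) ℂ) (hf : f.totalDegree ≤ n) (hL : complexity f ≤ s) :
    eval (coeffVector (degLEMonomials n) f)
      (aeval (fun ν => if ν = μ then (0 : MvPolynomial ↥(degLEMonomials n) ℂ) else X ν)
        ((pderiv μ)^[j] E)) = 0 := by
  rw [eval_killVar]
  have hpt : (fun ν => if ν = μ then (0 : ℂ) else coeffVector (degLEMonomials n) f ν) =
      fun ν => coeffVector (degLEMonomials n) f ν +
        if ν = μ then -coeffVector (degLEMonomials n) f μ else 0 := by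
    funext ν; split_ifs with h
    · subst h; ring
    · ring
  rw [hpt]
  exact iterate_pderiv_eval_line_eq_zero E _ μ (line_subset_zeros_sharp hE hf hL μ) j _

/-! ## §8 The sharp recursion: each rung `n + 1` of size DOUBLES the number of monomials -/

/-- **Sparsity wall, sharp step.**  A nonzero polynomial in the `C(2n,n)` coefficient variables
vanishing at `coeff(g)` for every `g` of degree `≤ n` and size `≤ s`, where `2n + 1 + r (n + 1) ≤ s`,
has at least `2^(r+1)` monomials. [folklore] -/
theorem card_support_ge_two_pow_sharp {n : ℕ} (r : ℕ) :
    ∀ {s : ℕ} {E : MvPolynomial ↥(degLEMonomials n) ℂ}, 2 * n + 1 + r * (n + 1) ≤ s → E ≠ 0 →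
      (∀ g : MvPolynomial (Fin n) ℂ, g.totalDegree ≤ n → complexity g ≤ s →
        eval (coeffVector (degLEMonomials n) g) E = 0) →
      2 ^ (r + 1) ≤ E.support.card := by
  induction r with
  | zero =>
    intro s E hs hE0 hE
    exact two_le_card_support (by simpa using hs) hE0 hE
  | succ r ih =>
    intro s E hs hE0 hE
    -- one sharp rung below `s`
    obtain ⟨s', rfl⟩ : ∃ s', s = s' + (n + 1) := ⟨s - (n + 1), by
      have : n + 1 ≤ s := by nlinarith
      omega⟩
    have hs' : 2 * n + 1 + r * (n + 1) ≤ s' := by nlinarith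
    -- `E` is not a monomial: split along a coordinate `μ`
    have h2 : 2 ≤ E.support.card := two_le_card_support (by omega) hE0 hE
    obtain ⟨μ, m₁, hm₁, hmin, hlt⟩ := exists_splitting_coordinate h2
    -- both pieces are nonzero equations for size `s'`
    have htop := ih hs' (top_ne_zero μ hE0)
      (fun g hg hgL => iterate_pderiv_vanishes_sharp hE μ _ g hg hgL)
    have hbot := ih hs' (bottom_ne_zero μ hm₁ hmin)
      (fun g hg hgL => killVar_iterate_pderiv_vanishes_sharp hE μ _ g hg hgL)
    have hpieces := card_support_pieces_le μ E hlt
    calc 2 ^ (r + 1 + 1) = 2 ^ (r + 1) + 2 ^ (r + 1) := by ring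
      _ ≤ _ := (Nat.add_le_add htop hbot).trans hpieces

/-! ## §9 At the crux -/

/-- **Sharp sparsity wall for equations of `SmallCircuits ℂ n b`**: if `2n + 1 + r(n+1) ≤ n^b`
then every nonzero `E` vanishing on `coeff(SmallCircuits ℂ n b)` has at least `2^(r+1)`
monomials. [folklore] -/
theorem card_support_ge_two_pow_smallCircuits_sharp {n b r : ℕ}
    (hr : 2 * n + 1 + r * (n + 1) ≤ n ^ b)
    {E : MvPolynomial ↥(degLEMonomials n) ℂ} (hE0 : E ≠ 0)
    (hE : ∀ f ∈ SmallCircuits ℂ n b, eval (coeffVector (degLEMonomials n) f) E = 0) :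
    2 ^ (r + 1) ≤ E.support.card :=
  card_support_ge_two_pow_sharp r hr hE0 fun g hg hgL => hE g ⟨hg, hgL⟩

/-- **The open rung `b = 2`, sharpened:** for `n ≥ 3`, every nonzero equation for
`SmallCircuits ℂ n 2` — in particular every Boolean-sum witness `boolSum H` of
`SingleSizeEquations` at `(n, 2)` — has at least `2^(n-2)` monomials (`2n + 1 + (n-3)(n+1) =
n² - 2 ≤ n²`).  Since `N = C(2n,n) ≤ 4^n`, this is `≥ √N / 4`: a `q = 0` witness presented as an
`o(√N)`-term polynomial is impossible; `N^a`-term witnesses with `a ≥ 1/2` are NOT excluded.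
[folklore] -/
theorem rung_two_card_support_sharp {n : ℕ} (hn : 3 ≤ n) {E : MvPolynomial ↥(degLEMonomials n) ℂ}
    (hE0 : E ≠ 0)
    (hE : ∀ f ∈ SmallCircuits ℂ n 2, eval (coeffVector (degLEMonomials n) f) E = 0) :
    2 ^ (n - 2) ≤ E.support.card := by
  obtain ⟨m, rfl⟩ : ∃ m, n = m + 3 := ⟨n - 3, by omega⟩
  have h := card_support_ge_two_pow_smallCircuits_sharp (n := m + 3) (b := 2) (r := m) ?_ hE0 hE
  · simpa [show m + 3 - 2 = m + 1 by omega] using h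
  · ring_nf; nlinarith [Nat.zero_le m]

/-- **The open rung in hitting form, sharpened:** for `n ≥ 3`, `SmallCircuits ℂ n 2` is a succinct
hitting set for all polynomials in the `C(2n,n)` coefficient variables with fewer than `2^(n-2)`
monomials (any degree, any circuit size of the distinguisher). [cite: ForbesShpilkaVolk2018, Cor. 34] -/
theorem isSuccinctHittingSet_sparse_rung_two_sharp {n : ℕ} (hn : 3 ≤ n) :
    IsSuccinctHittingSet (degLEMonomials n) (SmallCircuits ℂ n 2)
      {D : MvPolynomial ↥(degLEMonomials n) ℂ | D.support.card < 2 ^ (n - 2)} := by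
  intro D hD hD0
  by_contra hcon
  push Not at hcon
  exact absurd hD (not_lt.mpr (rung_two_card_support_sharp hn hD0 hcon))

/-- **Hitting form, every size bound, sharp step:** the coefficient vectors of the `n`-variate
polynomials of degree `≤ n` and size `≤ s`, `2n + 1 + r(n+1) ≤ s`, hit every nonzero polynomial in
the `C(2n,n)` coefficient variables with fewer than `2^(r+1)` monomials — size `≈ n · log₂(sparsity)`
with constant ONE. [cite: ForbesShpilkaVolk2018, Cor. 34] -/
theorem isSuccinctHittingSet_sparse_of_size_sharp {n r s : ℕ} (hs : 2 * n + 1 + r * (n + 1) ≤ s) :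
    IsSuccinctHittingSet (degLEMonomials n)
      {f : MvPolynomial (Fin n) ℂ | f.totalDegree ≤ n ∧ complexity f ≤ s}
      {D : MvPolynomial ↥(degLEMonomials n) ℂ | D.support.card < 2 ^ (r + 1)} := by
  intro D hD hD0
  by_contra hcon
  push Not at hcon
  have h := card_support_ge_two_pow_sharp r hs hD0 fun g hg hgL => hcon g ⟨hg, hgL⟩
  exact absurd hD (not_lt.mpr h)

/-! ## §10 The support wall with the sharp step: every monomial of an equation at `b = 2`
## involves at least `n` distinct coordinates (appended by the same seat)

With `L(t·x^μ) ≤ |μ| ≤ n` a `t`-sparse polynomial of degree `≤ n` costs `≤ t(n+1)` gates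
(`complexity_finset_sum_le`), so every coefficient vector supported on `≤ t` coordinates lies in
the size-`t(n+1)` class; by `DegreeLowerBound.lt_card_support_of_eval_eq_zero` every monomial of an
equation for that class involves `> t` coordinates.  At `b = 2`: `t = n - 1` (`(n-1)(n+1) ≤ n²`), so
every monomial of an equation for `SmallCircuits ℂ n 2` involves at least `n` distinct coefficient
variables and the equation has total degree `≥ n` (the tree's constant: `> n²/(2n+2) ≈ n/2`,
`DifferentialClosure.lt_card_support_of_vanishes` / `…Status`). -/

/-- A `t`-sparse polynomial `Σ_{μ ∈ S} t_μ x^μ` (`#S ≤ t`, all `|μ| ≤ n`) has degree `≤ n` and costs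
`≤ t (n + 1)` gates. [cite: Burgisser2000, §2.1] -/
theorem sparse_mem_of_card_le {n t : ℕ} (S : Finset ↥(degLEMonomials n)) (hS : S.card ≤ t)
    (v : ↥(degLEMonomials n) → ℂ) :
    (∑ μ ∈ S, monomial (μ : Fin n →₀ ℕ) (v μ) : MvPolynomial (Fin n) ℂ).totalDegree ≤ n ∧
      complexity (∑ μ ∈ S, monomial (μ : Fin n →₀ ℕ) (v μ) : MvPolynomial (Fin n) ℂ) ≤ t * (n + 1) := by
  have hdeg : ∀ μ : ↥(degLEMonomials n), (μ : Fin n →₀ ℕ).degree ≤ n := fun μ => μ.2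
  refine ⟨(totalDegree_finsetSum _ _).trans (Finset.sup_le fun μ _ => ?_), ?_⟩
  · refine (totalDegree_monomial_le _ _).trans ?_
    have h := hdeg μ
    rwa [Finsupp.degree_apply] at h
  · refine (complexity_finset_sum_le _ _).trans ?_
    have h1 : ∑ μ ∈ S, complexity (monomial (μ : Fin n →₀ ℕ) (v μ) : MvPolynomial (Fin n) ℂ) ≤
        ∑ _μ ∈ S, n :=
      Finset.sum_le_sum fun μ _ => (complexity_monomial_le_degree _ _).trans (hdeg μ)
    rw [Finset.sum_const, smul_eq_mul] at h1
    calc ∑ μ ∈ S, complexity (monomial (μ : Fin n →₀ ℕ) (v μ) : MvPolynomial (Fin n) ℂ) + S.card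
        ≤ S.card * n + S.card := Nat.add_le_add_right h1 _
      _ = S.card * (n + 1) := by ring
      _ ≤ t * (n + 1) := Nat.mul_le_mul_right _ hS

/-- **Support wall, sharp step.**  If `E` vanishes at `coeff(g)` for every `g` of degree `≤ n` and
size `≤ s` with `t (n + 1) ≤ s`, then every monomial of `E` involves more than `t` distinct
coefficient variables. [folklore] -/
theorem lt_card_support_of_vanishes_sharp {n s t : ℕ} (hts : t * (n + 1) ≤ s)
    {E : MvPolynomial ↥(degLEMonomials n) ℂ}
    (hE : ∀ g : MvPolynomial (Fin n) ℂ, g.totalDegree ≤ n → complexity g ≤ s →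
      eval (coeffVector (degLEMonomials n) g) E = 0)
    {d : ↥(degLEMonomials n) →₀ ℕ} (hd : d ∈ E.support) : t < d.support.card := by
  classical
  refine DegreeLowerBound.lt_card_support_of_eval_eq_zero (fun S hS v hv => ?_) hd
  obtain ⟨hdeg, hsize⟩ := sparse_mem_of_card_le S hS v
  have hcv : coeffVector (degLEMonomials n)
      (∑ μ ∈ S, monomial (μ : Fin n →₀ ℕ) (v μ) : MvPolynomial (Fin n) ℂ) = v := by
    funext ν
    rw [coeffVector_apply, coeff_sum]
    by_cases hν : ν ∈ S
    · rw [Finset.sum_eq_single_of_mem ν hν]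
      · rw [coeff_monomial, if_pos rfl]
      · intro μ _ hμν
        rw [coeff_monomial, if_neg]
        exact fun h => hμν (Subtype.ext h)
    · rw [hv ν hν]
      refine Finset.sum_eq_zero fun μ hμ => ?_
      rw [coeff_monomial, if_neg]
      exact fun h => hν ((Subtype.ext h : μ = ν) ▸ hμ)
  rw [← hcv]
  exact hE _ hdeg (hsize.trans hts)

/-- **At the open rung `b = 2`** (`n ≥ 1`): every monomial of a nonzero equation for
`SmallCircuits ℂ n 2` involves at least `n` distinct coefficient variables (`(n-1)(n+1) ≤ n²`).
[folklore] -/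
theorem rung_two_le_card_support_monomial {n : ℕ} {E : MvPolynomial ↥(degLEMonomials n) ℂ}
    (hE : ∀ f ∈ SmallCircuits ℂ n 2, eval (coeffVector (degLEMonomials n) f) E = 0)
    {d : ↥(degLEMonomials n) →₀ ℕ} (hd : d ∈ E.support) : n ≤ d.support.card := by
  have h := lt_card_support_of_vanishes_sharp (n := n) (s := n ^ 2) (t := n - 1)
    (by
      rcases Nat.eq_zero_or_pos n with rfl | hn
      · simp
      · obtain ⟨m, rfl⟩ : ∃ m, n = m + 1 := ⟨n - 1, by omega⟩
        rw [Nat.add_sub_cancel, sq]; nlinarith)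
    (fun g hg hgL => hE g ⟨hg, hgL⟩) hd
  omega

/-- … hence every nonzero equation for `SmallCircuits ℂ n 2` has total degree `≥ n`. [folklore] -/
theorem rung_two_le_totalDegree {n : ℕ} {E : MvPolynomial ↥(degLEMonomials n) ℂ} (hE0 : E ≠ 0)
    (hE : ∀ f ∈ SmallCircuits ℂ n 2, eval (coeffVector (degLEMonomials n) f) E = 0) :
    n ≤ E.totalDegree := by
  classical
  obtain ⟨d, hd⟩ : ∃ d, d ∈ E.support := by
    by_contra hno
    push Not at hno
    exact hE0 (MvPolynomial.support_eq_empty.mp (Finset.eq_empty_of_forall_notMem hno))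
  refine (rung_two_le_card_support_monomial hE hd).trans (le_trans ?_ (MvPolynomial.le_totalDegree hd))
  calc d.support.card = ∑ i ∈ d.support, 1 := by simp
    _ ≤ d.sum fun _ e => e := by
        unfold Finsupp.sum
        exact Finset.sum_le_sum fun i hi => Nat.one_le_iff_ne_zero.mpr (Finsupp.mem_support_iff.mp hi)

end SparsityWall

end Summit.ValiantsHypothesis.ValiantsHypothesis.Theorems.BarrierLeverDefinableEquations
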